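import Literature.Dynamics.NBody.AlbouyKaloshin2012SymmetricCCsFinal
import Literature.Dynamics.NBody.AlbouyKaloshin2012SliceBranchesComplex
import Mathlib.Tactic.NormNum

/-!
# Reflection-symmetric central configurations of `(1,1,b,b,c)`: complex zero-dimensionality of five slice systems suffices

Topic `Literature/Dynamics/NBody`; `pub-smale6` cell, seat 1 gen 3 (2026-08-19). Companion of
`AlbouyKaloshin2012RobertsSymmetricFinal.lean` for the GENERIC point of the equal-mass family `E₃₂ = {(1,1,b,b,c)}`:
`reflSymmCCs_finite'` (`AlbouyKaloshin2012SymmetricCCsFinal.lean`) says that for `b, c > 0`, `b ≠ 1`, `c ≠ 1`, `b ≠ c`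
ALL reflection-symmetric positive normalized central configurations of `(1,1,b,b,c)` are finite in number as soon as the
REAL solution sets of five slice branch systems are finite — `T12(b,c)` on `++++`, `+++−`, the same two for the relabelled
parameters `(b⁻¹, c b⁻¹)` (symmetry type (3 4)), and `T1234(b,c)` on `++` (Moulton's collinear finiteness being a theorem,
`Moulton1910Collinear.lean`). Here the five hypotheses are replaced by finiteness of the COMPLEX solution sets
(`t12BranchSetC`, `t1234BranchSetC` of `AlbouyKaloshin2012SliceBranchesComplex.lean`), which is what a zero-dimensional
Gröbner basis over `ℚ` would certify. For the sample point `(b,c) = (2,3)` the cell holds modular (mod-`p` F4) EVIDENCE —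
not certificates — for these systems (HOME `certs/modgb/README.md`, systems certified identical to the Lean conjuncts in
`certs/modgb/lean_crosscheck.json`). Elementary glue; no claim about any mass point is proved here.
-/

namespace Literature.Dynamics.NBody

/-- Generic `(1,1,b,b,c)` (`b, c > 0`, `b ≠ 1`, `c ≠ 1`, `b ≠ c`): if the complex solution sets of the five slice branch
systems are finite, then all reflection-symmetric positive normalized central configurations of `(1,1,b,b,c)` are finite
in number. [cite: AlbouyKaloshin2012, Proposition 7 p. 572; Remark 8 p. 583] -/
theorem reflSymmCCs_finite_of_complex {b c : ℝ} (hb : 0 < b) (hc : 0 < c) (hb1 : b ≠ 1) (hc1 : c ≠ 1) (hbc : b ≠ c)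
    (hA : (t12BranchSetC 1 1 1 1 b c).Finite) (hB : (t12BranchSetC 1 1 1 (-1) b c).Finite)
    (hA' : (t12BranchSetC 1 1 1 1 (b⁻¹ : ℝ) (c * b⁻¹ : ℝ)).Finite)
    (hB' : (t12BranchSetC 1 1 1 (-1) (b⁻¹ : ℝ) (c * b⁻¹ : ℝ)).Finite)
    (hC : (t1234BranchSetC 1 1 b c).Finite) : (reflSymmCCs (e32Masses b c)).Finite :=
  reflSymmCCs_finite' hb hc hb1 hc1 hbc
    (t12BranchSet_finite_of_complex (by simpa using hA)) (t12BranchSet_finite_of_complex (by simpa using hB))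
    (t12BranchSet_finite_of_complex (by simpa using hA')) (t12BranchSet_finite_of_complex (by simpa using hB'))
    (t1234BranchSet_finite_of_complex (by simpa using hC))

/-- The sample point `(b,c) = (2,3)` of the cell's computations: all reflection-symmetric positive normalized central
configurations of `(1,1,2,2,3)` are finite in number if the complex solution sets of `T12(2,3)` on `++++`, `+++−`,
`T12(1/2,3/2)` on `++++`, `+++−` and `T1234(2,3)` on `++` are finite. [cite: AlbouyKaloshin2012, Proposition 7 p. 572] -/
theorem reflSymmCCs_223_finite_of_complex
    (hA : (t12BranchSetC 1 1 1 1 2 3).Finite) (hB : (t12BranchSetC 1 1 1 (-1) 2 3).Finite)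
    (hA' : (t12BranchSetC 1 1 1 1 (1 / 2) (3 / 2)).Finite) (hB' : (t12BranchSetC 1 1 1 (-1) (1 / 2) (3 / 2)).Finite)
    (hC : (t1234BranchSetC 1 1 2 3).Finite) : (reflSymmCCs (e32Masses 2 3)).Finite := by
  have e1 : (((2 : ℝ)⁻¹ : ℝ) : ℂ) = 1 / 2 := by push_cast; norm_num
  have e2 : (((3 : ℝ) * (2 : ℝ)⁻¹ : ℝ) : ℂ) = 3 / 2 := by push_cast; norm_num
  have hA'' : (t12BranchSetC 1 1 1 1 (((2 : ℝ)⁻¹ : ℝ) : ℂ) (((3 : ℝ) * (2 : ℝ)⁻¹ : ℝ) : ℂ)).Finite := by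
    rw [e1, e2]; exact hA'
  have hB'' : (t12BranchSetC 1 1 1 (-1) (((2 : ℝ)⁻¹ : ℝ) : ℂ) (((3 : ℝ) * (2 : ℝ)⁻¹ : ℝ) : ℂ)).Finite := by
    rw [e1, e2]; exact hB'
  exact reflSymmCCs_finite_of_complex (b := 2) (c := 3) (by norm_num) (by norm_num) (by norm_num) (by norm_num)
    (show (2 : ℝ) ≠ 3 by norm_num) (by simpa using hA) (by simpa using hB) hA'' hB'' (by simpa using hC)

end Literature.Dynamics.NBody
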